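import Summits.NavierStokesRegularity.NavierStokesRegularity.Theses.FilamentSkeletonRss
import Summits.NavierStokesRegularity.NavierStokesRegularity.Theorems.FilamentSkeletonRssKelvinGateSharpLine1AG
import HarnessLib.Audit

/-!
# Line `kelvin_gate_sharp` (1AG form, v2 = TENURE RE-CUT (γ)) for the LIVE crux `FilamentSkeletonRss.TransverseReduction1AG`
# (stmt-NavierStokesRegularity-27853) — SECOND line; line of record stays `defect_column_gate_1AG`

v1 (tenure planner g14, sha16 15e56edc958c16f1 = 27853 evidence #10; crux-dir commit 418d2f7a64a1): stubs `stub_dressedBase1A :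
KelvinGate.DressedBase1A`, `stub_sharpGate1A : KelvinGate.EventualSharpGate1A` (the 1A = A1α forms, registered on the aside 27414) +
clause monotonicity.  v2 (prover lane ns-filament-21221-p1 g9, 2026-08-28): the stubs are RE-CUT to the A1G class per tenure ruling (γ)
of 2026-08-28T14:09:31Z, using the landed `Theorems/FilamentSkeletonRssKelvinGateSharpLine1AG.lean` (p641137, commit 1f4c74b15f4f):

* S1′ `stub_dressedBase1AG : KelvinGate.DressedBase1AG` (L/XL) — for every box INCLUDING `KA` ∃ `C_b c_b` ∀ `k` ∃ `C_r Γ₁` ∀ `Γ ≥ Γ₁`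
  ∀ A1G skeleton (clauses 0–13J + area law + the Γ-flat cone bound (d7) `Rw²Γ·Aa j τ ≤ KA(Rw²Γ + ‖X j τ‖²)` IN THE HYPOTHESIS) ∃ `α₁ U⁰ P⁰`
  with `KelvinGate.BaseSpec1A k C_b c_b C_r` (dressing to every order AT THE FINAL RATE, in the sharp scales `X♯_{3/2}/Y♯_{3/2}`).
  Why re-cut: MODEL job j306611 KILL-1 «matched-kernel datum lost» — a dressing residual `C_rΓ^(−k)` in `Y♯_{3/2}` needs matched cores
  wherever the Biot–Savart kernel is integrated, which is what (d7) + core matching provide; over un-matched A1α skeletons v1's S1′ claimed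
  more than the cone needs.  Why-might-fail (unchanged): first-order rate transversality `⟨ψ*, 𝓡U⁰⟩ ≠ 0` hidden in the `∃ α₁`.
* S2′ `stub_sharpGate1AG : KelvinGate.EventualSharpGate1AG` (XL, KILL-FIRST, the crux of this line) — an EVENTUAL sharp Kelvin gate
  `SharpGateSpec (3/2) (A₀Γ^κ) α₁ U⁰ K 𝒬` around every dressed base of every A1G skeleton (constants may depend on `KA`); no rate multiplier.
  NEW TOOL (p641848, `…KelvinGateSharpContinuation`): in the sharp scales the gate EXISTS at any base along whose ray `{tU⁰ : t ∈ [0,1]}` a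
  UNIFORM A-PRIORI BOUND `SharpApriori (3/2) B α₁ (tU⁰)` holds, with bound `max B (C(1+4MB))` — so S2′ is an ESTIMATE (Kelvin-mode /
  Liouville analysis at the O(Γ) column), not an existence problem.  Cheapest falsifier: a real eigenvalue of the Γ-free waist operator
  on a wall skeleton (route KILL CRITERIA (ii)).
* Composition: `KelvinGate.TransverseReduction1AG_of_sharp1AG : DressedBase1AG → EventualSharpGate1AG → TransverseReduction1AG`
  (sorry-free, p641137; S3′+S4′ = `SharpGateSpec.closing_smooth` p638510).  Monotonicity (p641137): the v1 / 27414-registered stubs imply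
  the v2 stubs (`dressedBase1AG_of_1A`, `eventualSharpGate1AG_of_1A`), so a by-name proof of either form serves this line.

Hardest stub: `stub_sharpGate1AG`.  Barriers / Disproof used: card `Lines/kelvin_gate_sharp_1AG.md`.  NOT `skeleton check`-registered on
27853 (one skeleton of record per crux; a lead switching to this line registers it then).
HONEST FRAMING: MODEL rung, NEGATIVE side of ¬(Tsai Con 1.8 rotated); both stubs OPEN; `TransverseReduction1AG` is neither proved nor
refuted here; nothing in this file bears on Navier–Stokes regularity.
-/

set_option linter.dupNamespace false

namespace Summit.NavierStokesRegularity.NavierStokesRegularity.Cruxes.TransverseReduction1AG.KelvinGateSharp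

open Summit.NavierStokesRegularity.NavierStokesRegularity.Theorems.KelvinGate
open Summit.NavierStokesRegularity.NavierStokesRegularity.Theses.FilamentSkeletonRss

/-- Stub S1′ re-cut (L/XL): dressed A1G skeleton AT THE FINAL RATE, to every order, in the sharp scales (`DressedBase1AG`). -/
theorem stub_dressedBase1AG : DressedBase1AG := by
  sorry

/-- Stub S2′ re-cut (XL, KILL-FIRST — the crux of this line): eventual sharp Kelvin gate around every dressed base of every A1G skeleton. -/
theorem stub_sharpGate1AG : EventualSharpGate1AG := by
  sorry

/-- The crux from the line, hypothesis-free, BY NAME (audit: concludes `…Theses.FilamentSkeletonRss.TransverseReduction1AG`;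
sorries = the two stubs). -/
theorem TransverseReduction1AG_of : TransverseReduction1AG :=
  TransverseReduction1AG_of_sharp1AG stub_dressedBase1AG stub_sharpGate1AG

end Summit.NavierStokesRegularity.NavierStokesRegularity.Cruxes.TransverseReduction1AG.KelvinGateSharp
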